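/-
Copyright: statement-level skeleton of a published paper (lit-balaban cell, Phase-2 proof seat p19, gen 4). No claims beyond
what the kernel checks below.
-/
import Mathlib
import Literature.MathematicalPhysics.QuantumFieldTheory.Balaban1983to89.B3IBPSites

/-!
# B3 — T. Bałaban, *(Higgs)₂,₃ quantum fields in a finite volume. III. Renormalization*, CMP **88** (1983) 411–445
[Balaban1983Higgs3] — Sect. 2, p. 424: the graph (2.4) as a count datum; it is a (2.4)-block of degree `0`

statement-level skeleton of published theorems with citation tags; proofs where landed; nothing here is a claim about
the Yang–Mills mass gap

PDF held: `paper:balaban1983-higgs-2-3-quantum-fields-finite-volume` (journal page = PDF page + 410).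

Part of the Phase-2 work on SKELETON rows **B3.Prop2.1 / B3.Prop2.2** (unit `lit-balaban-p19` gen 4, HOME
`run/shared/lean/pub/lit-balaban/`), a worked instance for the (2.4) EXCEPTION files `B3IBPSites` → … → `B3Prop21Except24`.

WHAT IS REPRODUCED.  p. 424 [PDF 14], verbatim: *"To have not too much restricted formulation of this theorem, let us
introduce the following special graph with a degree equal to 0: (2.4)"* — two vertices of type (1.8) joined by one scalar
line into which both derivative legs `∂^η φ′` are contracted, each vertex keeping one external scalar and one external vector
leg.  KERNEL-CHECKED HERE: the count datum `graph24` of (2.4) in `d = 3` (one line `0 → 1`, one differentiation of each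
endpoint acting on it, no η-powers); its only block `G₁ = G` has line dimension `a = −(d−2) − 2 = −3` and degree
`D = (3+0) + (3+0) − 3 − 3 = 0` exactly as printed (`degQ_graph24`), so the positivity hypothesis of Prop. 2.1 without the
exception FAILS for it (`not_pos_graph24`) while it IS a (2.4)-block (`is24Block_graph24`) and its line is a site of the
integration by parts (2.8) (`mem_sites_graph24`) — the exception clause of `B3Prop21Except24.prop21_except24` is not vacuous.
-/

open Finset

namespace Literature.MathematicalPhysics.QuantumFieldTheory.Balaban1983to89.B3Ineq213

open B3Ineq215

/-- The graph (2.4) as a count datum (`d = 3`, `L = 2`, `δ₁ = 1`): vertices `0, 1`, one scalar line `0 → 1` carrying one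
differentiation of each endpoint, no averaged vector legs on it, η-powers `0` (vertices (1.8) with `n + n′ = 1`).
[cite: Balaban1983Higgs3, (2.4) p.424] -/
noncomputable def graph24 : Counts (Fin 2) 1 where
  src := fun _ => 0
  tgt := fun _ => 1
  touches := fun v => ⟨0, by fin_cases v <;> simp⟩
  diffOn := fun _ _ => 1
  vecLegAvg := fun _ _ => 0
  etaPow := fun _ => 0
  d := 3
  L := 2
  δ₁ := 1
  d_pos := by norm_num
  two_le_L := le_rfl
  δ₁_pos := one_pos

/-- After shrinking the only line both vertices lie in the block of the first endpoint `0`. [cite: Balaban1983Higgs3, (2.16) p.428] -/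
theorem rep_one_graph24 (v : Fin 2) : graph24.toModel.rep 1 v = 0 := by
  rw [graph24.toModel.rep_succ Nat.zero_lt_one v]
  unfold Model.rho Model.bs Model.bt
  simp only [Model.rep_zero]
  fin_cases v <;> simp [graph24, Counts.toModel]

/-- The block `G₁` of (2.4) is the whole vertex set. [cite: Balaban1983Higgs3, (2.16) p.428] -/
theorem fiber_one_graph24 : graph24.toModel.fiber 1 0 = univ := by
  ext v; simp [Model.mem_fiber, rep_one_graph24]

/-- Its line set is the single line `0`. [cite: Balaban1983Higgs3, (2.16) p.428] -/
theorem before_one_graph24 : graph24.toModel.before 1 0 = {0} := by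
  ext l
  simp only [Model.mem_before, rep_one_graph24, and_true, mem_singleton, Fin.eq_zero l, Fin.val_zero,
    Nat.zero_lt_one]

/-- **a = −(d−2) − 2 = −3**: two scalar legs of dimension `−½` each and two differentiations. [cite: Balaban1983Higgs3, (2.14) p.427] -/
theorem lineDimQ_graph24 : lineDimQ graph24 0 = -3 := by
  unfold lineDimQ legExpQ Counts.legsOn
  simp [graph24, Fin.sum_univ_two]

/-- **"a degree equal to 0"**: `D((2.4)) = (3+0) + (3+0) − 3 + (−3) = 0` by (2.2). [cite: Balaban1983Higgs3, (2.4) p.424] -/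
theorem degQ_graph24 : degQ graph24 1 0 = 0 := by
  unfold degQ
  rw [fiber_one_graph24, before_one_graph24, sum_singleton, lineDimQ_graph24]
  simp [graph24]
  norm_num

/-- Hence the hypothesis "all connected subgraphs `G_i` have positive degrees" (Prop. 2.1 WITHOUT the exception) fails for
(2.4). [cite: Balaban1983Higgs3, Prop. 2.1 p.424] -/
theorem not_pos_graph24 : ¬ 0 < degQ graph24 1 0 := by
  rw [degQ_graph24]; exact lt_irrefl 0

/-- (2.4) is a (2.4)-block in the sense of `Is24Block` (degree `0`, a single line with two different endpoints and a
differentiation of its first endpoint on it). [cite: Balaban1983Higgs3, (2.4) p.424] -/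
theorem is24Block_graph24 : Is24Block graph24 1 0 :=
  ⟨degQ_graph24, 0, by simp [graph24], by simp [graph24], before_one_graph24⟩

/-- Its line is a site of the integration by parts (2.8). [cite: Balaban1983Higgs3, (2.8) p.425] -/
theorem mem_sites_graph24 : (0 : Fin 1) ∈ sites graph24 := by
  obtain ⟨l, hl, -⟩ := is24Block_graph24.exists_site
  rwa [Fin.eq_zero l] at hl

end Literature.MathematicalPhysics.QuantumFieldTheory.Balaban1983to89.B3Ineq213
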